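import Summits.BirchSwinnertonDyer.BirchSwinnertonDyer.Theorems.SignedBaseChangeTwistPairGreenbergProductDivisibilityCanonicalFrameData
import Summits.BirchSwinnertonDyer.BirchSwinnertonDyer.Theorems.BiquadraticEisensteinDescentHeegnerFieldSupplyEvenRung
import Literature.NumberTheory.QuadraticFields.KroneckerSplitting
import HarnessLib

/-!
# K1″ `TwistPairGreenbergProductDivisibilityCanonical` (stmt-BirchSwinnertonDyer-20519, route SignedBaseChange): its `∃`-half
# FD″ WITH ONE MORE CONJUNCT `p ∤ h_K` — the Heegner frame data of K1's twist pair CAN be chosen with class number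
# prime to `p`, GRANTED Beckwith–Raum–Richter 2022 Thm. 1 (route-independent helper, `--supports stmt-BirchSwinnertonDyer-20727`)

Lead prover `bsd-line-sbc-p1` gen 5 (cell `bsd-ssimc`). THEOREM ONLY (no definition, no named fact of its own, no `sorry`).

WHY. The crux `AnticyclotomicEisensteinDivisibility` (stmt-BirchSwinnertonDyer-20727, child of K1″ along `acanchor`) quantifies
over EVERY Heegner field `K` of the twist pair; on the sub-cell `p ∣ h_K` its line `bdpline` (v26) carries two stubs with no
source in print ((a2) `stub_xAcTorsionSS_classDvd`, S1∣ `stub_bdpLowerHalfRatSS_classDvd`: the anticyclotomic signed theory of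
Iovita–Pollack / B.-D. Kim / Longo–Vigni / Castella–Wan is typed in the tree under `AcSigned.Setting.not_dvd_classNumber`). K1″ itself
quantifies `K` EXISTENTIALLY; its `∃`-half FD″ (`SignedBaseChangeK1FrameDataCanonical.stub_frameDataBCSsplit_canonical`, lead g4 of
the wall cell) picks `K = ℚ(√−q)` by the unconditional CRT/Dirichlet supply `Quadratic.exists_imaginaryQuadratic_forall_split`, with no
control of `h_K`. The width seat bsd-line-sbc-p1-w2 (gen 6) recorded that the refereed class-number-indivisibility supplies with
prescribed splitting (Beckwith–Raum–Richter IMRN 2024 Thm. 1, Wiles 2015, Beckwith 2017) prescribe ODD split primes only, while K1″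
demands `2` split. THIS FILE records that the tree ALREADY has the even rung: `BiquadraticEisensteinDescentHeegnerFieldSupplyEvenRung.
exists_twoSplit_split_not_dvd_classNumber` (route BED; `d_K ≡ 1 (mod 8)` so `2` splits, every odd prime of a finite set splits,
`|d_K| > B`, `ℓ ∤ h_K` for a prime `ℓ > 3`), CONDITIONAL on the single REFEREED named fact
`Literature.NumberTheory.QuadraticFields.BRR2022_thm_1` (Beckwith–Raum–Richter, Adv. Math. 409 (2022) 108663, Thm. 1; Hurwitz class
numbers on square classes) — and proves with it **FD‴ = FD″ ∧ `¬ p ∣ NumberField.classNumber K`** (`stub_frameDataBCSsplit_canonical_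
coprimeClassNumber`): FD″'s statement VERBATIM with the one extra conjunct appended LAST, under the one extra hypothesis `BRR2022_thm_1`.

PROOF = FD″'s (p525981 / the canonical version), with the field supplied by the even rung at `S = {p, ℓ} ∪ {odd primes of N}`,
`B = N + p + ℓ` (`ℓ ≡ 1 (mod 8)` the twist prime, chosen FIRST with its prescribed residues): `(N, d_K) = 1` and `ℓ ∤ d_K` now come
from "an odd split prime does not divide `d_K`" (`Quadratic.ncard_primesOver_eq_two_iff_legendreSym`) and `d_K` odd; `d_K ≠ −3` and
`d_K` odd from `d_K ≡ 1 (mod 8)`. Consequence (companion files of this seat): with the crux restated under the binder `¬ p ∣ h_K`, K1″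
still follows from its two `acanchor` children and `BRR2022_thm_1` — the two `p ∣ h_K` research stubs leave the route's critical path
for one refereed class-number fact. CONDITIONAL on `BRR2022_thm_1` and on modularity-with-parametrisation (as FD″); closes nothing by
itself. No summit statement / BSD is proved by this file.

References: [BeckwithRaumRichter2022] O. Beckwith, M. Raum, O. K. Richter, Adv. Math. 409 (2022) 108663, Thm. 1; [Cox2013] Thm. 7.24,
Thm. 7.7 (ii); [Marcus2018] Ch. 3 Thm. 25 (decomposition law in quadratic fields).
-/

-- D-0017: single-problem summit, the namespace repeats the problem name by design.
set_option linter.dupNamespace false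
set_option autoImplicit false

noncomputable section

open scoped Classical
open NumberField IsDedekindDomain Field WeierstrassCurve
open Literature.NumberTheory.EllipticCurves Literature.NumberTheory.GaloisRepresentations
  Literature.NumberTheory.EllipticCurves.ModularForms
open Literature.NumberTheory.QuadraticFields (BRR2022_thm_1)
open Summit.BirchSwinnertonDyer.BirchSwinnertonDyer.Theorems.SignedBaseChangeK1FrameData
open Summit.BirchSwinnertonDyer.BirchSwinnertonDyer.Theorems.SignedBaseChangeK1FrameDataBCS
open Summit.BirchSwinnertonDyer.BirchSwinnertonDyer.Theorems.SignedBaseChangeK1FrameDataCanonical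
open Summit.BirchSwinnertonDyer.BirchSwinnertonDyer.Theorems.BiquadraticEisensteinDescentHeegnerFieldSupplyEvenRung
  (exists_twoSplit_split_not_dvd_classNumber)

namespace Summit.BirchSwinnertonDyer.BirchSwinnertonDyer.Theorems.SignedBaseChangeK1FrameDataCoprimeClassNumber

/-- **FD‴ = FD″ ∧ `p ∤ h_K`, GRANTED Beckwith–Raum–Richter 2022 Thm. 1.** For every globally minimal `W/ℚ`, prime `p ≥ 5` with
`ClassX7 W p` and `Surj W p`, granted modularity with parametrisation: K1's frame data `(K, ι, v, v̄, κ₁, κ₂, γ₁, γ₂, N, f, d, W′, C,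
N′, f′)` with the base-change splitting package AND the canonical normalisation of `γ₁` — the statement of
`SignedBaseChangeK1FrameDataCanonical.stub_frameDataBCSsplit_canonical` VERBATIM — AND `¬ p ∣ NumberField.classNumber K` (last
conjunct). The field is the even-rung Heegner field of `exists_twoSplit_split_not_dvd_classNumber` (so the proof is CONDITIONAL on
the refereed named fact `BRR2022_thm_1`, hypothesis `h22`). [cite: BeckwithRaumRichter2022, Theorem 1]
[cite: Cox2013, §7.D Thm. 7.24 and §7.B Thm. 7.7 (ii)] [cite: Marcus2018, Ch. 3 Thm. 25] -/
theorem stub_frameDataBCSsplit_canonical_coprimeClassNumber : BRR2022_thm_1 → Literature.NumberTheory.EllipticCurves.ModularForms.nonempty_modularParametrizationData → ∀ (W : WeierstrassCurve ℚ) [W.IsElliptic] [W.IsGloballyMinimal] (p : ℕ) [Fact p.Prime], 5 ≤ p → Literature.NumberTheory.EllipticCurves.Rank1Residual.ClassX7 W p → Literature.NumberTheory.EllipticCurves.Rank1Residual.Surj W p → ∃ (K : Type) (_ : Field K) (_ : NumberField K) (ι : PadicAlgCl p ≃+* ℂ) (v vbar : IsDedekindDomain.HeightOneSpectrum (NumberField.RingOfIntegers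 K)) (κ₁ κ₂ : Literature.NumberTheory.EllipticCurves.ZpExtension K p) (γ₁ γ₂ : Field.absoluteGaloisGroup K) (_ : Fact (Literature.NumberTheory.EllipticCurves.ZpExtension.IsTopGeneratorPair κ₁ κ₂ γ₁ γ₂)) (_ : NeZero (NumberField.discr K).natAbs) (N : ℕ) (_ : NeZero N) (f : CuspForm (CongruenceSubgroup.Gamma0 N) 2) (d : ℤ) (W' : WeierstrassCurve ℚ) (_ : W'.IsElliptic) (_ : W'.IsGloballyMinimal) (C : WeierstrassCurve.VariableChange ℚ) (N' : ℕ) (_ : NeZero N') (f' : CuspForm (CongruenceSubgroup.Gamma0 N') 2), Literature.NumberTheory.EllipticCurves.ModularForms.IsNewformOf W f ∧ (N : ℤ) = W.conductorNorm ℤ ∧ Literature.NumberTheory.EllipticCurves.ModularForms.IsNewformOf W' f' ∧ (N' : ℤ) = W'.conductorNorm ℤ ∧ Squarefree d ∧ 1 < d ∧ (∀ q : ℕ, q.Prime → Literature.NumberTheory.EllipticCurves.BurungaleSkinnerTianWan2024.RamifiedInQuadratic d q → q ≠ p ∧ ¬ q ∣ N ∧ ¬ (q : ℤ) ∣ NumberField.discr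 K) ∧ C • W' = W.quadraticTwist (d : ℚ) ∧ Literature.NumberTheory.EllipticCurves.IsImaginaryQuadratic K ∧ ((Ideal.span {(p : ℤ)}).primesOver (NumberField.RingOfIntegers K)).ncard = 2 ∧ ((p : ℕ) : NumberField.RingOfIntegers K) ∈ v.asIdeal ∧ ((p : ℕ) : NumberField.RingOfIntegers K) ∈ vbar.asIdeal ∧ vbar ≠ v ∧ (∀ (w : NumberField.InfinitePlace K) (k : NumberField.RingOfIntegers K), k ∈ v.asIdeal ↔ ‖ι.symm (w.embedding (k : K))‖ < 1) ∧ IsCoprime (N : ℤ) (NumberField.discr K) ∧ (∀ ρ : Literature.NumberTheory.GaloisRepresentations.ModPGaloisRep K (ZMod p) 2, (W.baseChange K).IsTorsionGaloisRep p ρ → Literature.NumberTheory.GaloisRepresentations.FramedRep.IsAbsolutelyIrreducible ρ) ∧ κ₁.IsCyclotomic ∧ κ₂.IsAnticyclotomic ∧ (∃ ζ : ℤ_[p]ˣ, IsOfFinOrder ζ ∧ ((Literature.NumberTheory.GaloisRepresentations.GaloisRep.cyclotomicCharacter K p γ₁ * ζ : ℤ_[p]ˣ) : ℤ_[p]) =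 (Literature.NumberTheory.EllipticCurves.cyclotomicGenerator p : ℤ_[p])) ∧ (∀ ℓ : ℕ, ℓ.Prime → ℓ ∣ N → ((Ideal.span {(ℓ : ℤ)}).primesOver (NumberField.RingOfIntegers K)).ncard = 2) ∧ ((Ideal.span {(2 : ℤ)}).primesOver (NumberField.RingOfIntegers K)).ncard = 2 ∧ (Odd (NumberField.discr K) ∧ NumberField.discr K ≠ -3) ∧ d % 8 = 1 ∧ (∀ ℓ : ℕ, ℓ.Prime → (ℓ : ℤ) ∣ d → ((Ideal.span {(ℓ : ℤ)}).primesOver (NumberField.RingOfIntegers K)).ncard = 2) ∧ (((d : ℤ) : ZMod p) ≠ 0 ∧ IsSquare ((d : ℤ) : ZMod p)) ∧ (∀ ℓ : ℕ, ℓ.Prime → ℓ ∣ N → ℓ ≠ 2 → ((d : ℤ) : ZMod ℓ) ≠ 0 ∧ (IsSquare ((d : ℤ) : ZMod ℓ) ↔ ¬ p ∣ ℓ + 1)) ∧ ¬ p ∣ NumberField.classNumber K := by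
  intro h22 hmodP W _ _ p _ hp hX hs
  have hpP : p.Prime := Fact.out
  have hp2 : p ≠ 2 := by omega
  -- the newform of `W`; `p ∤ N` (good reduction at `p`)
  haveI hN0 : NeZero (W.conductorNorm ℤ) := ⟨(WeierstrassCurve.conductorNorm_pos_holds W).ne'⟩
  obtain ⟨D⟩ := hmodP W
  set N : ℕ := W.conductorNorm ℤ with hNdef
  have hpN : ¬ p ∣ N := not_dvd_conductorNorm_of_hasGoodReductionAtPrime W hX.1.1
  -- §1 the twist prime `ℓ`: residues prescribed at `p` and at the odd primes of `N`
  set A : Finset ℕ := insert p ((N.primeFactors.erase 2).filter (fun ℓ ↦ ¬ p ∣ ℓ + 1)) with hAdef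
  set B : Finset ℕ := (N.primeFactors.erase 2).filter (fun ℓ ↦ p ∣ ℓ + 1) with hBdef
  have hmemE : ∀ ℓ ∈ N.primeFactors.erase 2, ℓ.Prime ∧ ℓ ≠ 2 ∧ ℓ ∣ N := fun ℓ hℓ ↦ by
    rw [Finset.mem_erase, Nat.mem_primeFactors] at hℓ
    exact ⟨hℓ.2.1, hℓ.1, hℓ.2.2.1⟩
  have hA : ∀ a ∈ A, a.Prime ∧ a ≠ 2 := fun a ha ↦ by
    rw [hAdef, Finset.mem_insert] at ha
    rcases ha with rfl | ha
    · exact ⟨hpP, hp2⟩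
    · rw [Finset.mem_filter] at ha
      exact ⟨(hmemE a ha.1).1, (hmemE a ha.1).2.1⟩
  have hB : ∀ b ∈ B, b.Prime ∧ b ≠ 2 := fun b hb ↦ by
    rw [hBdef, Finset.mem_filter] at hb
    exact ⟨(hmemE b hb.1).1, (hmemE b hb.1).2.1⟩
  have hAB : Disjoint A B := by
    rw [Finset.disjoint_left]
    intro a haA haB
    rw [hAdef, Finset.mem_insert] at haA
    rw [hBdef, Finset.mem_filter] at haB
    rcases haA with rfl | haA
    · exact hpN (hmemE _ haB.1).2.2
    · rw [Finset.mem_filter] at haA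
      exact haA.2 haB.2
  obtain ⟨ℓ, hℓ, hℓgt, -, -, hℓ8, hℓA, hℓB⟩ := exists_prime_one_mod_eight_prescribed A B hA hB hAB (N + p)
  have hℓ4 : ℓ ≡ 1 [MOD 4] := by unfold Nat.ModEq; omega
  -- the field (EVEN RUNG, granted Beckwith–Raum–Richter 2022 Thm. 1): `d_K ≡ 1 (mod 8)` so `2` splits; `p`, `ℓ` and
  -- the odd primes of `N` split; `|d_K| > N + p + ℓ`; and `p ∤ h_K`
  have hℓ2 : ℓ ≠ 2 := by omega
  set S : Finset ℕ := insert p (insert ℓ (N.primeFactors.erase 2)) with hSdef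
  have hSodd : ∀ q ∈ S, q.Prime ∧ q ≠ 2 := fun q hq ↦ by
    rw [hSdef, Finset.mem_insert, Finset.mem_insert] at hq
    rcases hq with rfl | rfl | hq
    · exact ⟨hpP, hp2⟩
    · exact ⟨hℓ, hℓ2⟩
    · exact ⟨(hmemE q hq).1, (hmemE q hq).2.1⟩
  obtain ⟨K, _, _, h2K, htc, hBd, hd8, hsplit2, hsplitS, hcl⟩ :=
    exists_twoSplit_split_not_dvd_classNumber h22 hpP (by omega) S hSodd (N + p + ℓ)
  have hK : IsImaginaryQuadratic K := ⟨h2K, htc⟩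
  have hsplit : ((Ideal.span {(p : ℤ)}).primesOver (𝓞 K)).ncard = 2 :=
    hsplitS p (by rw [hSdef]; exact Finset.mem_insert_self _ _)
  have hsplitℓ : ((Ideal.span {(ℓ : ℤ)}).primesOver (𝓞 K)).ncard = 2 :=
    hsplitS ℓ (by rw [hSdef]; exact Finset.mem_insert_of_mem (Finset.mem_insert_self _ _))
  have hTN : ∀ l : ℕ, l.Prime → l ∣ N →
      ((Ideal.span {(l : ℤ)}).primesOver (𝓞 K)).ncard = 2 := fun l hl hlN ↦ by
    by_cases hl2 : l = 2
    · subst hl2; exact_mod_cast hsplit2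
    · refine hsplitS l ?_
      rw [hSdef, Finset.mem_insert, Finset.mem_insert, Finset.mem_erase, Nat.mem_primeFactors]
      exact Or.inr (Or.inr ⟨hl2, hl, hlN, hN0.out⟩)
  -- split odd primes do not divide the discriminant; hence `(N, d_K) = 1` and `ℓ ∤ d_K`
  have hnd : ∀ l : ℕ, l.Prime → l ≠ 2 → ((Ideal.span {(l : ℤ)}).primesOver (𝓞 K)).ncard = 2 →
      ¬ (l : ℤ) ∣ NumberField.discr K := fun l hl hl2 hls hdvd ↦ by
    haveI : Fact l.Prime := ⟨hl⟩
    have h1 : legendreSym l (NumberField.discr K) = 1 :=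
      (Literature.NumberTheory.QuadraticFields.Quadratic.ncard_primesOver_eq_two_iff_legendreSym h2K hl2).mp hls
    rw [(legendreSym.eq_zero_iff l _).mpr ((ZMod.intCast_zmod_eq_zero_iff_dvd _ l).mpr hdvd)] at h1
    exact zero_ne_one h1
  have hcopN : IsCoprime (N : ℤ) (NumberField.discr K) := by
    rw [Int.isCoprime_iff_gcd_eq_one, Int.gcd_eq_natAbs, Int.natAbs_natCast]
    refine Nat.coprime_of_dvd fun k hk hkN hkd ↦ ?_
    have hkd' : (k : ℤ) ∣ NumberField.discr K := Int.natCast_dvd.mpr hkd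
    by_cases hk2 : k = 2
    · subst hk2; omega
    · exact hnd k hk hk2 (hTN k hk hkN) hkd'
  -- places above `p`, embedding datum, tower
  obtain ⟨v, vbar, hv, hvbar, hne⟩ := exists_pair_of_ncard_primesOver_eq_two hpP hsplit
  obtain ⟨ι, hι⟩ := exists_iota hK v hv
  obtain ⟨κ₁, κ₂, γ₁, γ₂, hpair, hcyc, hanti, hcan⟩ :=
    exists_isTopGeneratorPair_isCyclotomic_isAnticyclotomic_canonical (p := p) hK hp2
  haveI : Fact (ZpExtension.IsTopGeneratorPair κ₁ κ₂ γ₁ γ₂) := ⟨hpair⟩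
  haveI : NeZero (NumberField.discr K).natAbs := ⟨by omega⟩
  -- the twist `W^{(ℓ)}` and its minimal model
  have hℓ0 : ((ℓ : ℤ) : ℚ) ≠ 0 := by exact_mod_cast hℓ.ne_zero
  haveI := W.isElliptic_quadraticTwist hℓ0
  obtain ⟨C₀, hC₀⟩ := WeierstrassCurve.hasGlobalMinimalModel_rat_holds (W.quadraticTwist ((ℓ : ℤ) : ℚ))
  haveI : (C₀ • W.quadraticTwist ((ℓ : ℤ) : ℚ)).IsGloballyMinimal := hC₀
  haveI hN0' : NeZero ((C₀ • W.quadraticTwist ((ℓ : ℤ) : ℚ)).conductorNorm ℤ) :=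
    ⟨(WeierstrassCurve.conductorNorm_pos_holds _).ne'⟩
  obtain ⟨D'⟩ := hmodP (C₀ • W.quadraticTwist ((ℓ : ℤ) : ℚ))
  refine ⟨K, inferInstance, inferInstance, ι, v, vbar, κ₁, κ₂, γ₁, γ₂, inferInstance, inferInstance, N,
    inferInstance, D.f, (ℓ : ℤ), C₀ • W.quadraticTwist ((ℓ : ℤ) : ℚ), inferInstance, hC₀, C₀⁻¹,
    (C₀ • W.quadraticTwist ((ℓ : ℤ) : ℚ)).conductorNorm ℤ, inferInstance, D'.f, D.isNewformOf, rfl,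
    D'.isNewformOf, rfl, ?_, ?_, ?_, inv_smul_smul C₀ _, hK, hsplit, hv, hvbar, hne, hι, ?_, ?_, hcyc, hanti,
    hcan, hTN, hsplit2, ?_, ?_, ?_, ?_, ?_, hcl⟩
  · -- `ℓ` square-free
    exact Int.squarefree_natCast.mpr hℓ.squarefree
  · -- `1 < ℓ`
    exact_mod_cast hℓ.one_lt
  · -- ramified in `ℚ(√ℓ)` only at `ℓ`, and `ℓ ∤ p N d_K`
    intro q' hq' hram
    obtain rfl := eq_of_ramifiedInQuadratic hℓ hℓ4 hq' hram
    refine ⟨by omega, fun h ↦ ?_, fun h ↦ ?_⟩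
    · exact absurd (Nat.le_of_dvd (Nat.pos_of_ne_zero hN0.out) h) (by omega)
    · exact hnd q' hℓ hℓ2 hsplitℓ h
  · -- `(N, d_K) = 1`
    exact hcopN
  · -- (irr_K), framed
    exact fun ρ hρ ↦ irrK_framed_of_surj W p hp2 hs K hK.1 ρ hρ
  · -- (disc): `d_K ≡ 1 (mod 8)` is odd and `≠ -3`
    refine ⟨?_, ?_⟩
    · rw [Int.odd_iff]; omega
    · omega
  · -- `d ≡ 1 (mod 8)`
    omega
  · -- the primes of `d = ℓ` split in `K`
    intro l hl hdvd
    obtain rfl : l = ℓ := (Nat.prime_dvd_prime_iff_eq hl hℓ).mp (Int.natCast_dvd_natCast.mp hdvd)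
    exact hsplitℓ
  · -- `d ≡ 1` is a non-zero square mod `p` (`p` SPLIT in `ℚ(√d)`)
    rw [Int.cast_natCast, hℓA p (by rw [hAdef]; exact Finset.mem_insert_self _ _)]
    exact ⟨one_ne_zero, ⟨1, (mul_one 1).symm⟩⟩
  · -- odd `ℓ' ∣ N`: `d` a non-zero square mod `ℓ'` iff `p ∤ ℓ' + 1`
    intro l hl hlN hl2
    haveI : Fact l.Prime := ⟨hl⟩
    have hlE : l ∈ N.primeFactors.erase 2 := by
      rw [Finset.mem_erase, Nat.mem_primeFactors]; exact ⟨hl2, hl, hlN, hN0.out⟩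
    rw [Int.cast_natCast]
    by_cases hpl : p ∣ l + 1
    · have hlB : l ∈ B := by
        rw [hBdef, Finset.mem_filter]; exact ⟨hlE, hpl⟩
      obtain ⟨hne0, hnsq⟩ := hℓB l hlB
      exact ⟨hne0, iff_of_false hnsq (not_not.mpr hpl)⟩
    · have hlA : l ∈ A := by
        rw [hAdef, Finset.mem_insert, Finset.mem_filter]; exact Or.inr ⟨hlE, hpl⟩
      rw [hℓA l hlA]
      exact ⟨one_ne_zero, iff_of_true ⟨1, (mul_one 1).symm⟩ hpl⟩

end Summit.BirchSwinnertonDyer.BirchSwinnertonDyer.Theorems.SignedBaseChangeK1FrameDataCoprimeClassNumber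

end
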